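import Literature.Analysis.FluidPDE.SereginSverakPressureProofs
import Literature.Analysis.FluidPDE.Seregin2020AncientLimit
import Literature.Analysis.FluidPDE.LocalTypeIScaling
import Literature.Analysis.FluidPDE.SuitableWeakRescaling
import Literature.Analysis.FluidPDE.SpaceTimeRescaling
import Literature.Analysis.FluidPDE.ClassicalSolutionRescale

/-!
# Crux `SelfMixingDichotomy.SequentialTypeIExclusion` (stmt-NavierStokesRegularity-1424), line
  `registered`: STUB `stub_centredTypeITangentFlow` — the tangent flow at a Type-I singular point

Lands `--supports stmt-NavierStokesRegularity-1424` the registered stub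
`stub_centredTypeITangentFlow` of the lead's skeleton (reshape r2): for a classical Leray–Hopf
solution (`ν = 1`) of Navier–Stokes on `ℝ³ × [0, T)` from a rapidly decaying datum and a point `x₀`
with a centred cubic Type-I bound `C(r; T, x₀) ≤ M'` (`0 < r < r₁`,
`C = Literature.Analysis.FluidPDE.cknC` on the backward cylinders `Q_r(T, x₀)`) at which `u` is NOT
bounded on any `(T − ρ², T) × B_ρ(x₀)`, there is a tangent flow: `K`, `κ > 0` and a pair `(w, π)`
on `ℝ × ℝ³`, backward-singular at the origin, which on every `Q(a)`, `a > 0`, is a suitable weak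
solution in Albritton–Barker's class with `w ∈ L³(Q(a))`, `A(a), C(a), D(a) ≤ K` and `C(a) ≥ κ`
(Seregin 2014 notes, Prop. 6.20; Seregin–Shilkin 2018, Thm. 3.5; Seregin 2020, proof of Thm. 2.1,
(2.8)–(2.9) and properties (𝒜); Albritton–Barker 2019, Lemma 2.2 / Prop. 2.3).

The whole analytic content is the tree's `Seregin2020.exists_ancientLimit` (extraction of the
blow-up limit at a Type-I singular point of a suitable weak solution on Seregin's unit cylinder
`𝒞 × ]-1, 0[`, with the bounds, the non-triviality and the singularity passing to the limit).
This file is glue: it moves the final-time point `(T, x₀)` of the gauged pair to the origin of the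
unit cylinder by the Navier–Stokes scaling with `λ = √T` and verifies the seven hypotheses of the
extraction theorem:

1. gauge the pressure, `q = p − (p(·, 0) − p̃[u](0))`: `(u, q)` is a suitable weak solution on the
   slab `(0, T) × ℝ³` (`SereginSverak2002.isSuitableWeakSolutionOn_gauge_of_classical`) with
   `∬ |q|^{3/2} < ∞` (`SereginSverak2002.lintegral_slab_gauged_pressure_lt_top`) and a square
   integrable weak spatial gradient (`IsLerayHopfOn.exists_hasWeakSpatialGradientOn`);
2. the zoom `v = λ u(T + λ² s, x₀ + λ y)`, `π = λ² q(…)`, `G' = λ² G(…)` with `λ² = T` maps the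
   unit cylinder into the slab; suitability and the weak gradient are covariant
   (`IsSuitableWeakSolutionOn.stRescale`, `HasWeakSpatialGradientOn.stRescale`), the classes
   `∇v ∈ L²`, `π ∈ L^{3/2}` and the sliced energy bound follow by the change of variables
   (`setLIntegral_frobeniusNormSq_stRescale`, `setLIntegral_enorm_rpow_stRescale`,
   `lintegral_comp_space_affine`, `SereginSverak2002.eEnergy_le`);
3. the origin is a backward singular point of `v`: an essential bound of `v` on some `Q(0, r)` is
   one of `u` on `Q_{λr}(T, x₀)` (`eLpNorm_top_nsZoom`), hence — `u` being continuous below `T` —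
   a pointwise bound on a backward cylinder at `(T, x₀)`, excluded by hypothesis;
4. the blow-up index is finite: `g(0) ≤ limsup_{r→0} C(r; 0, v) = limsup C(λr; T, x₀; u) ≤ M'`
   (`cknC_nsZoom`, `Seregin2020.blowupIndex_le_limsup_cknC`);
5. apply `Seregin2020.exists_ancientLimit` and forget the scales and the convergence statements.
-/

noncomputable section

-- the summit and its single problem share the name (D-0017 nested layout)
set_option linter.dupNamespace false

namespace Summit.NavierStokesRegularity.NavierStokesRegularity.Theorems.SequentialTypeIExclusion.Registered

open scoped ENNReal NNReal Topology
open Literature.Analysis.FluidPDE Set Filter MeasureTheory Function Metric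

/-! ### The unit cylinder under the zoom `Φ(s, y) = (T + c² s, x₀ + c y)`, `c² = T` -/

/-- `Φ` maps Seregin's unit cylinder `𝒞 × (-1, 0)` into the slab `(0, T) × ℝ³` when `c² = T`. -/
private theorem parCyl_subset_preimage_slab {T c : ℝ} (hc2 : c ^ 2 = T) (hT : 0 < T)
    (x₀ : EuclideanSpace ℝ (Fin 3)) :
    SereginSverak2009.parCyl 0 1 ⊆
      stAffine (c ^ 2) c T x₀ ⁻¹' (Ioo 0 T ×ˢ (univ : Set (EuclideanSpace ℝ (Fin 3)))) := by
  intro z hz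
  rw [SereginSverak2009.mem_parCyl_zero] at hz
  obtain ⟨⟨h1, h2⟩, -, -⟩ := hz
  norm_num at h1
  rw [mem_preimage, hc2]
  refine ⟨⟨?_, ?_⟩, mem_univ _⟩
  · show 0 < T + T * z.1
    nlinarith
  · show T + T * z.1 < T
    nlinarith

/-- The same inclusion, for the open sets. -/
private theorem parCylOpens_le_stPreimage {T c : ℝ} (hc2 : c ^ 2 = T) (hT : 0 < T)
    (x₀ : EuclideanSpace ℝ (Fin 3)) :
    SereginSverak2009.parCylOpens 0 1 ≤
      stPreimage (c ^ 2) c T x₀ (slab (EuclideanSpace ℝ (Fin 3)) (Ioo 0 T) isOpen_Ioo) :=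
  fun _ hz => parCyl_subset_preimage_slab hc2 hT x₀ hz

/-- `Φ(0) = (T, x₀)`. -/
private theorem stAffine_apply_zero (β γ T : ℝ) (x₀ : EuclideanSpace ℝ (Fin 3)) :
    stAffine β γ T x₀ (0 : ℝ × EuclideanSpace ℝ (Fin 3)) = (T, x₀) :=
  Prod.ext (by simp [stAffine]) (by simp [stAffine])

/-! ### The seven hypotheses of the extraction theorem for the zoomed pair -/

/-- (1) The zoom of a suitable weak solution on the slab is a suitable weak solution (`ν = 1`,
no force) on the unit cylinder. -/
private theorem suitable_zoom {T c : ℝ} (hc : 0 < c) (hc2 : c ^ 2 = T) (hT : 0 < T)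
    (x₀ : EuclideanSpace ℝ (Fin 3))
    {u : ℝ → EuclideanSpace ℝ (Fin 3) → EuclideanSpace ℝ (Fin 3)}
    {q : ℝ → EuclideanSpace ℝ (Fin 3) → ℝ}
    (hsw : IsSuitableWeakSolutionOn (slab (EuclideanSpace ℝ (Fin 3)) (Ioo 0 T) isOpen_Ioo)
      1 0 u q) :
    IsSuitableWeakSolutionOn (SereginSverak2009.parCylOpens 0 1) 1 0
      (c • stPull (c ^ 2) c T x₀ u) (c ^ 2 • stPull (c ^ 2) c T x₀ q) := by
  have h1 := hsw.stRescale (α := c) (β := c ^ 2) (γ := c) hc hc (by ring) T x₀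
  rw [show c * 1 / c = 1 by field_simp, smul_stPull_zero] at h1
  exact h1.of_le (parCylOpens_le_stPreimage hc2 hT x₀)

/-- (2) The sliced energy of the zoom on the unit cylinder is bounded by `c² c⁻³ · 2 E(u₀)`. -/
private theorem sliceEnergy_zoom {T c : ℝ} (hc : 0 < c) (hc2 : c ^ 2 = T) (hT : 0 < T)
    (x₀ : EuclideanSpace ℝ (Fin 3))
    {u : ℝ → EuclideanSpace ℝ (Fin 3) → EuclideanSpace ℝ (Fin 3)}
    (hLH : IsLerayHopfOn T 1 0 (u 0) u) :
    ∃ C : ℝ≥0, ∀ᵐ t ∂(volume.restrict (Ioo (-1 : ℝ) 0)),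
      ∫⁻ x in SereginSverak2009.spaceCyl 0 1, ‖(c • stPull (c ^ 2) c T x₀ u) t x‖ₑ ^ 2 ≤ C := by
  set K : ℝ≥0∞ := ENNReal.ofReal c ^ 2 * (ENNReal.ofReal (c ^ 3)⁻¹ *
    ENNReal.ofReal (2 * VectorCalculus.kineticEnergy (u 0))) with hK
  have hKtop : K ≠ ∞ := ENNReal.mul_ne_top (ENNReal.pow_ne_top ENNReal.ofReal_ne_top)
    (ENNReal.mul_ne_top ENNReal.ofReal_ne_top ENNReal.ofReal_ne_top)
  refine ⟨K.toNNReal, ?_⟩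
  rw [ENNReal.coe_toNNReal hKtop]
  filter_upwards [ae_restrict_mem measurableSet_Ioo] with s hs
  have ht : T + c ^ 2 * s ∈ Icc 0 T := by
    have h1 := mul_pos hT (show (0 : ℝ) < 1 + s by linarith [hs.1])
    have h2 := mul_neg_of_pos_of_neg hT hs.2
    rw [hc2]
    exact ⟨by nlinarith, by nlinarith⟩
  calc ∫⁻ x in SereginSverak2009.spaceCyl 0 1, ‖(c • stPull (c ^ 2) c T x₀ u) s x‖ₑ ^ 2
      ≤ ∫⁻ x, ‖(c • stPull (c ^ 2) c T x₀ u) s x‖ₑ ^ 2 := setLIntegral_le_lintegral _ _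
    _ = ∫⁻ x, ENNReal.ofReal c ^ 2 * ‖u (T + c ^ 2 * s) (x₀ + c • x)‖ₑ ^ 2 := by
        refine lintegral_congr fun x => ?_
        rw [smul_stPull_apply, enorm_smul, mul_pow, Real.enorm_eq_ofReal hc.le]
    _ = ENNReal.ofReal c ^ 2 *
          (ENNReal.ofReal (c ^ 3)⁻¹ * ∫⁻ x, ‖u (T + c ^ 2 * s) x‖ₑ ^ 2) := by
        rw [lintegral_const_mul' _ _ (by simp),
          lintegral_comp_space_affine hc x₀ (fun x => ‖u (T + c ^ 2 * s) x‖ₑ ^ 2),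
          finrank_euclideanSpace_fin]
    _ ≤ K := by
        rw [hK]
        gcongr
        exact SereginSverak2002.eEnergy_le zero_le_one hLH ht

/-- (3) The zoomed weak spatial gradient, restricted to the unit cylinder. -/
private theorem weakGradient_zoom {T c : ℝ} (hc : 0 < c) (hc2 : c ^ 2 = T) (hT : 0 < T)
    (x₀ : EuclideanSpace ℝ (Fin 3))
    {u : ℝ → EuclideanSpace ℝ (Fin 3) → EuclideanSpace ℝ (Fin 3)}
    {G : ℝ → EuclideanSpace ℝ (Fin 3) → EuclideanSpace ℝ (Fin 3) →L[ℝ] EuclideanSpace ℝ (Fin 3)}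
    (hG : HasWeakSpatialGradientOn (slab (EuclideanSpace ℝ (Fin 3)) (Ioo 0 T) isOpen_Ioo) u G) :
    HasWeakSpatialGradientOn (SereginSverak2009.parCylOpens 0 1) (c • stPull (c ^ 2) c T x₀ u)
      (c ^ 2 • stPull (c ^ 2) c T x₀ G) := by
  have h := hG.stRescale c (pow_pos hc 2) hc T x₀
  rw [← sq] at h
  exact h.mono (parCylOpens_le_stPreimage hc2 hT x₀)

/-- (4) `∇v ∈ L²` of the unit cylinder. -/
private theorem lintegral_parCyl_grad_lt_top {T c : ℝ} (hc : 0 < c) (hc2 : c ^ 2 = T) (hT : 0 < T)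
    (x₀ : EuclideanSpace ℝ (Fin 3))
    {G : ℝ → EuclideanSpace ℝ (Fin 3) → EuclideanSpace ℝ (Fin 3) →L[ℝ] EuclideanSpace ℝ (Fin 3)}
    (hGint : ∫⁻ z in Ioo 0 T ×ˢ (univ : Set (EuclideanSpace ℝ (Fin 3))),
      ENNReal.ofReal (frobeniusNormSq (G z.1 z.2)) < ∞) :
    ∫⁻ z in SereginSverak2009.parCyl 0 1,
      ENNReal.ofReal (frobeniusNormSq ((c ^ 2 • stPull (c ^ 2) c T x₀ G) z.1 z.2)) < ∞ := by
  refine (lintegral_mono_set (parCyl_subset_preimage_slab hc2 hT x₀)).trans_lt ?_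
  rw [setLIntegral_frobeniusNormSq_stRescale (pow_pos hc 2) hc]
  exact ENNReal.mul_lt_top (ENNReal.mul_lt_top ENNReal.ofReal_lt_top ENNReal.ofReal_lt_top) hGint

/-- (5) `π ∈ L^{3/2}` of the unit cylinder. -/
private theorem lintegral_parCyl_pressure_lt_top {T c : ℝ} (hc : 0 < c) (hc2 : c ^ 2 = T)
    (hT : 0 < T) (x₀ : EuclideanSpace ℝ (Fin 3)) {q : ℝ → EuclideanSpace ℝ (Fin 3) → ℝ}
    (hqint : ∫⁻ z in Ioo 0 T ×ˢ (univ : Set (EuclideanSpace ℝ (Fin 3))),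
      ‖q z.1 z.2‖ₑ ^ (3 / 2 : ℝ) < ∞) :
    ∫⁻ z in SereginSverak2009.parCyl 0 1,
      ‖(c ^ 2 • stPull (c ^ 2) c T x₀ q) z.1 z.2‖ₑ ^ (3 / 2 : ℝ) < ∞ := by
  refine (lintegral_mono_set (parCyl_subset_preimage_slab hc2 hT x₀)).trans_lt ?_
  rw [setLIntegral_enorm_rpow_stRescale (pow_pos hc 2) hc T x₀ (c ^ 2) q _
    (by norm_num : (0 : ℝ) ≤ 3 / 2)]
  exact ENNReal.mul_lt_top (ENNReal.mul_lt_top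
    (ENNReal.rpow_lt_top_of_nonneg (by norm_num) enorm_ne_top) ENNReal.ofReal_lt_top) hqint

/-- The backward cylinder `Q_r(T, x₀)` with `r² ≤ T` lies in `[0, T) × ℝ³`. -/
private theorem parabolicCylinder_subset_Ico {T r : ℝ} (hr : r ^ 2 ≤ T)
    (x₀ : EuclideanSpace ℝ (Fin 3)) :
    parabolicCylinder r ((T, x₀) : ℝ × EuclideanSpace ℝ (Fin 3)) ⊆
      Ico 0 T ×ˢ (univ : Set (EuclideanSpace ℝ (Fin 3))) := by
  intro w hw
  simp only [mem_parabolicCylinder] at hw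
  exact ⟨⟨by linarith [hw.1.1], hw.1.2⟩, mem_univ _⟩

/-- An essential bound of `u` on a backward cylinder `Q_s(T, x₀)` is a pointwise bound on a
smaller one, `u` being continuous below `T`. -/
private theorem bdd_of_eLpNorm_top_ne_top {T s : ℝ} (hT : 0 < T) (hs : 0 < s)
    {x₀ : EuclideanSpace ℝ (Fin 3)}
    {u : ℝ → EuclideanSpace ℝ (Fin 3) → EuclideanSpace ℝ (Fin 3)}
    {p : ℝ → EuclideanSpace ℝ (Fin 3) → ℝ} (hcl : IsClassicalNSSolutionOn (Ico 0 T) 1 0 u p)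
    (hfin : eLpNorm (uncurry u) ∞ (volume.restrict
      (parabolicCylinder s ((T, x₀) : ℝ × EuclideanSpace ℝ (Fin 3)))) ≠ ∞) :
    ∃ ρ : ℝ, 0 < ρ ∧ ∃ M : ℝ, ∀ t ∈ Ioo (T - ρ ^ 2) T, ∀ x ∈ ball x₀ ρ, ‖u t x‖ ≤ M := by
  set ρ : ℝ := min s (Real.sqrt T)
  have hρ : 0 < ρ := lt_min hs (Real.sqrt_pos.2 hT)
  have hρT : ρ ^ 2 ≤ T := by
    calc ρ ^ 2 ≤ Real.sqrt T ^ 2 := pow_le_pow_left₀ hρ.le (min_le_right _ _) 2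
      _ = T := Real.sq_sqrt hT.le
  have hVs : parabolicCylinder ρ ((T, x₀) : ℝ × EuclideanSpace ℝ (Fin 3)) ⊆
      parabolicCylinder s ((T, x₀) : ℝ × EuclideanSpace ℝ (Fin 3)) :=
    parabolicCylinder_mono hρ.le (min_le_left _ _) _
  have hfinV : eLpNorm (uncurry u) ∞ (volume.restrict
      (parabolicCylinder ρ ((T, x₀) : ℝ × EuclideanSpace ℝ (Fin 3)))) ≠ ∞ :=
    ne_top_of_le_ne_top hfin (eLpNorm_mono_measure _ (Measure.restrict_mono_set _ hVs))
  have hae : ∀ᵐ w ∂(volume.restrict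
      (parabolicCylinder ρ ((T, x₀) : ℝ × EuclideanSpace ℝ (Fin 3)))),
      ‖uncurry u w‖ ≤ (eLpNorm (uncurry u) ∞ (volume.restrict
        (parabolicCylinder ρ ((T, x₀) : ℝ × EuclideanSpace ℝ (Fin 3))))).toReal := by
    have h1 := ae_le_eLpNormEssSup (μ := volume.restrict
      (parabolicCylinder ρ ((T, x₀) : ℝ × EuclideanSpace ℝ (Fin 3)))) (f := uncurry u)
    rw [eLpNorm_exponent_top] at hfinV ⊢
    filter_upwards [h1] with w hw
    exact (toReal_enorm (uncurry u w)) ▸ ENNReal.toReal_mono hfinV hw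
  have hcont : ContinuousOn (uncurry u)
      (parabolicCylinder ρ ((T, x₀) : ℝ × EuclideanSpace ℝ (Fin 3))) :=
    (SereginSverak2002.continuousOn_uncurry hcl).mono (parabolicCylinder_subset_Ico hρT x₀)
  have hall := SereginSverak2002.norm_le_of_ae_restrict_of_continuousOn
    (isOpen_parabolicCylinder ρ _) hcont hae
  refine ⟨ρ, hρ, _, fun t ht x hx => hall (t, x) ?_⟩
  rw [mem_parabolicCylinder]
  exact ⟨⟨ht.1, ht.2⟩, mem_ball.1 hx⟩

/-- (6) The origin is a backward singular point of the zoom when `u` is bounded on no backward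
cylinder at `(T, x₀)`. -/
private theorem backwardSingular_zoom {T c : ℝ} (hc : 0 < c) (hT : 0 < T)
    (x₀ : EuclideanSpace ℝ (Fin 3))
    {u : ℝ → EuclideanSpace ℝ (Fin 3) → EuclideanSpace ℝ (Fin 3)}
    {p : ℝ → EuclideanSpace ℝ (Fin 3) → ℝ} (hcl : IsClassicalNSSolutionOn (Ico 0 T) 1 0 u p)
    (hB : ¬ ∃ ρ : ℝ, 0 < ρ ∧ ∃ M : ℝ, ∀ t ∈ Ioo (T - ρ ^ 2) T, ∀ x ∈ ball x₀ ρ, ‖u t x‖ ≤ M) :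
    IsBackwardSingularPoint (c • stPull (c ^ 2) c T x₀ u) 0 := by
  intro r hr
  by_contra hne
  refine hB (bdd_of_eLpNorm_top_ne_top hT (mul_pos hc hr) hcl fun htop => hne ?_)
  rw [eLpNorm_top_nsZoom hc, stAffine_apply_zero, htop]
  exact ENNReal.mul_top (ENNReal.ofReal_pos.2 hc).ne'

/-- (7) The blow-up index of the zoom at the origin is finite under the centred Type-I bound
`C(r; T, x₀) ≤ M'`, `0 < r < r₁`. -/
private theorem blowupIndex_zoom_lt_top {T c : ℝ} (hc : 0 < c)
    (x₀ : EuclideanSpace ℝ (Fin 3))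
    (u : ℝ → EuclideanSpace ℝ (Fin 3) → EuclideanSpace ℝ (Fin 3))
    (G' : ℝ → EuclideanSpace ℝ (Fin 3) → EuclideanSpace ℝ (Fin 3) →L[ℝ] EuclideanSpace ℝ (Fin 3))
    {M' r₁ : ℝ} (hr₁ : 0 < r₁)
    (hTI : ∀ r ∈ Ioo 0 r₁,
      cknC r ((T, x₀) : ℝ × EuclideanSpace ℝ (Fin 3)) u ≤ ENNReal.ofReal M') :
    Seregin2020.blowupIndex 0 (c • stPull (c ^ 2) c T x₀ u) G' < ∞ := by
  refine (Seregin2020.blowupIndex_le_limsup_cknC 0 _ G').trans_lt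
    (lt_of_le_of_lt ?_ (ENNReal.ofReal_lt_top (r := M')))
  refine limsup_le_of_le (by isBoundedDefault) ?_
  filter_upwards [Ioo_mem_nhdsGT (div_pos hr₁ hc)] with r hr
  rw [cknC_nsZoom hc hr.1, stAffine_apply_zero]
  exact hTI _ ⟨mul_pos hc hr.1, (lt_div_iff₀' hc).1 hr.2⟩

/-- **STUB `stub_centredTypeITangentFlow` — the tangent flow at a centred Type-I singular point**
(Seregin 2014 notes, Prop. 6.20; Seregin–Shilkin 2018, Thm. 3.5; Seregin 2020, proof of Thm. 2.1,
(2.8)–(2.9) and properties (𝒜); Albritton–Barker 2019, Lemma 2.2 / Prop. 2.3). For a classical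
Leray–Hopf solution (`ν = 1`) of Navier–Stokes on `ℝ³ × [0, T)` from a rapidly decaying datum and
`x₀` with a centred cubic Type-I bound `C(r; T, x₀) ≤ M'` (`0 < r < r₁`) at which `u` is NOT
bounded on any `(T − ρ², T) × B_ρ(x₀)`, there is a tangent flow: `K`, `κ > 0` and a pair `(w, π)`
on `ℝ × ℝ³`, backward-singular at the origin, which on every `Q(a) = (−a², 0) × B_a(0)`, `a > 0`,
is a suitable weak solution in Albritton–Barker's class with `w ∈ L³(Q(a))`,
`A(a), C(a), D(a) ≤ K` and `C(a) ≥ κ`. Proof: the gauged pair, zoomed about `(T, x₀)` by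
`λ = √T`, satisfies the hypotheses of `Seregin2020.exists_ancientLimit`. -/
theorem stub_centredTypeITangentFlow :
    ∀ M' : ℝ, ∀ T : ℝ, 0 < T →
      ∀ (u : ℝ → EuclideanSpace ℝ (Fin 3) → EuclideanSpace ℝ (Fin 3))
        (p : ℝ → EuclideanSpace ℝ (Fin 3) → ℝ),
        Literature.Analysis.FluidPDE.IsClassicalNSSolutionOn (Set.Ico 0 T) 1 0 u p →
        Literature.Analysis.FluidPDE.IsLerayHopfOn T 1 0 (u 0) u →
        Literature.Analysis.FluidPDE.HasRapidSpatialDecay (u 0) →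
        ∀ x₀ : EuclideanSpace ℝ (Fin 3),
          (∃ r₁ : ℝ, 0 < r₁ ∧ ∀ r ∈ Set.Ioo 0 r₁,
            Literature.Analysis.FluidPDE.cknC r ((T, x₀) : ℝ × EuclideanSpace ℝ (Fin 3)) u ≤ ENNReal.ofReal M') →
          (¬ ∃ ρ : ℝ, 0 < ρ ∧ ∃ M : ℝ, ∀ t ∈ Set.Ioo (T - ρ ^ 2) T, ∀ x ∈ Metric.ball x₀ ρ, ‖u t x‖ ≤ M) →
          ∃ (K : NNReal) (κ : ℝ) (w : ℝ → EuclideanSpace ℝ (Fin 3) → EuclideanSpace ℝ (Fin 3))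
            (π : ℝ → EuclideanSpace ℝ (Fin 3) → ℝ),
            0 < κ ∧ Literature.Analysis.FluidPDE.IsBackwardSingularPoint w 0 ∧
            ∀ a : ℝ, 0 < a →
              Literature.Analysis.FluidPDE.IsSuitableWeakSolutionInBall a 0 w π ∧
              MeasureTheory.MemLp (Function.uncurry w) 3 (MeasureTheory.volume.restrict
                (Literature.Analysis.FluidPDE.parabolicCylinder a (0 : ℝ × EuclideanSpace ℝ (Fin 3)))) ∧
              Literature.Analysis.FluidPDE.cknAEss a (0 : ℝ × EuclideanSpace ℝ (Fin 3)) w ≤ K ∧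
              Literature.Analysis.FluidPDE.cknC a (0 : ℝ × EuclideanSpace ℝ (Fin 3)) w ≤ K ∧
              Literature.Analysis.FluidPDE.cknD a (0 : ℝ × EuclideanSpace ℝ (Fin 3)) π ≤ K ∧
              ENNReal.ofReal κ ≤ Literature.Analysis.FluidPDE.cknC a (0 : ℝ × EuclideanSpace ℝ (Fin 3)) w := by
  rintro M' T hT u p hcl hLH - x₀ ⟨r₁, hr₁, hTI⟩ hB
  -- ### Step 1: the gauged suitable weak solution on the slab `(0, T) × ℝ³`
  set q : ℝ → EuclideanSpace ℝ (Fin 3) → ℝ :=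
    fun t x => p t x - (p t 0 - normalisedPressure (u t) 0)
  have hsw0 : IsSuitableWeakSolutionOn
      (slab (EuclideanSpace ℝ (Fin 3)) (Ioo 0 T) isOpen_Ioo) 1 0 u q :=
    SereginSverak2002.isSuitableWeakSolutionOn_gauge_of_classical one_pos hT hcl hLH _
      (coe_slab _ _).subset
  obtain ⟨G, hG0, -, hGint, -⟩ := hLH.exists_hasWeakSpatialGradientOn
  have hqint : ∫⁻ w in Ioo 0 T ×ˢ (univ : Set (EuclideanSpace ℝ (Fin 3))),
      ‖q w.1 w.2‖ₑ ^ (3 / 2 : ℝ) < ∞ :=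
    SereginSverak2002.lintegral_slab_gauged_pressure_lt_top one_pos hT hcl hLH
  -- ### Step 2: the zoom about `(T, x₀)` by `c = √T` and the seven hypotheses
  obtain ⟨c, hc, hc2⟩ : ∃ c : ℝ, 0 < c ∧ c ^ 2 = T :=
    ⟨Real.sqrt T, Real.sqrt_pos.2 hT, Real.sq_sqrt hT.le⟩
  have hsw := suitable_zoom hc hc2 hT x₀ hsw0
  have hA := sliceEnergy_zoom hc hc2 hT x₀ hLH
  have hG := weakGradient_zoom hc hc2 hT x₀ hG0
  have hE := lintegral_parCyl_grad_lt_top hc hc2 hT x₀ hGint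
  have hp := lintegral_parCyl_pressure_lt_top hc hc2 hT x₀ hqint
  have hsing := backwardSingular_zoom hc hT x₀ hcl hB
  have hI := blowupIndex_zoom_lt_top hc x₀ u (c ^ 2 • stPull (c ^ 2) c T x₀ G) hr₁ hTI
  -- ### Step 3: the extraction
  obtain ⟨K, κ, _lam, w, π', hκ, -, -, hsingw, hall⟩ :=
    Seregin2020.exists_ancientLimit hsw hA hG hE hp hsing hI
  refine ⟨K, κ, w, π', hκ, hsingw, fun a ha => ?_⟩
  obtain ⟨h1, h2, -, -, h5, h6, h7, h8⟩ := hall a ha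
  exact ⟨h1, h2, h5, h6, h7, h8⟩

end Summit.NavierStokesRegularity.NavierStokesRegularity.Theorems.SequentialTypeIExclusion.Registered

end
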